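import Literature.Probability.LatticeModels.LatticePotentialKernel
import Literature.Probability.LatticeModels.GreenFunctionConformalRadius
import Mathlib.MeasureTheory.Function.JacobianOneDim
import Mathlib.MeasureTheory.Integral.IntervalIntegral.Periodic
import Mathlib.Analysis.SpecialFunctions.ImproperIntegrals
import Mathlib.Analysis.SpecialFunctions.Integrals.Basic
import Mathlib.Analysis.SpecialFunctions.Trigonometric.ArctanDeriv
import Mathlib.NumberTheory.Harmonic.EulerMascheroni
import HarnessLib

/-!
# The planar potential kernel on the diagonal: `a(n,n) = (2/π) Σ_{k=1}^{n} 1/(2k-1)`, and the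
# constant `(2γ + 3 log 2)/π`

Topic `Literature/Probability/LatticeModels`; companion of `LatticePotentialKernel.lean` (the
potential kernel of `ℤ²` in Fourier form, `a(x) = (2π)⁻² ∫_{[-π,π]²} (1 - cos p·x)/ε(p) dp`,
normalised by `Δ a = 2δ₀`, i.e. HALF of the kernel of Spitzer / Lawler–Limic) and a proved step of
the printed proof of Kozdron–Lawler's Theorem 1.2 (`GreenFunctionConformalRadius.lean`, eq. (16):
"`a(x) = (2/π) log |x| + k₀ + o(|x|^{-3/2})` where `k₀ = (2ς + 3 ln 2)/π`"): the classical EXACT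
VALUE of the potential kernel on the diagonal (McCrea–Whipple 1940; Spitzer 1976, §15, P3;
Lawler–Limic 2010, proof of Thm. 4.4.4), from which the constant `k₀` is read off by the harmonic
sum `Σ_{k≤n} 1/(2k-1) = ½ log n + log 2 + γ/2 + O(1/n)`.

## Main results

* `integral_inv_one_sub_mul_cos` — `∫_{-π}^{π} dp/(1 - c cos p) = 2π/√(1 - c²)` (`|c| < 1`;
  Weierstrass substitution `p = 2 arctan t`);
* `integral_inv_two_sub_cos_sub_cos` — `∫_{-π}^{π} dp/(2 - cos p - cos(s - p)) = π/|sin(s/2)|`;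
* `latticePotentialKernel_diagonal` — **`a(n, n) = (2/π) Σ_{k<n} 1/(2k+1)`** (tree
  normalisation; `= (4/π) Σ 1/(2k-1)` for the Lawler–Limic kernel): shear `p₂ = s - p₁` on the
  torus, Fubini, the two integrals above, and `(1 - cos 2nu)/sin u = 2 Σ_{k<n} sin((2k+1)u)`;
* `abs_latticePotentialKernel_diagonal_sub_log_sub_le` — **`|a(n,n) - (1/π) log |(n,n)| - k₀/2| ≤ 2/(π n)`**
  with `k₀ = KozdronLawler.greenConst = (2γ + 3 log 2)/π` (`|(n,n)| = n√2`), from Mathlib's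
  bounds `H_m - log(m+1) < γ < H_m - log m` on Euler's constant.

So IF `a(x) - (1/π) log |x|` converges as `|x| → ∞` (Stöhr 1950; Lawler–Limic Thm. 4.4.4 — the
business of the planned `LatticePotentialKernelAsymptotics.lean`, not proved here), its limit is
`k₀/2`; nothing about off-diagonal `x` is claimed in this file. No named fact is introduced.

## References

* G. F. Lawler, V. Limic, *Random Walk: A Modern Introduction*, CUP (2010), §4.4, Thm. 4.4.4 and
  its proof (the constant `(2γ + log 8)/π`) [LawlerLimic2010].
* F. Spitzer, *Principles of Random Walk*, 2nd ed. (1976), §15, P3 (`a(n,n) = (4/π) Σ 1/(2k-1)`).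
* M. J. Kozdron, G. F. Lawler, Electron. J. Probab. 10 (2005), §2.3 eq. (16) [KozdronLawler2005].
-/

noncomputable section

open MeasureTheory Set Filter Real intervalIntegral
open scoped Topology BigOperators

namespace Literature.Probability.LatticeModels

namespace PotentialKernelDiagonal

/-! ### `∫_{-π}^{π} dp / (1 - c cos p) = 2π / √(1 - c²)` -/

/-- The Weierstrass integrand: `2/(1+t²) · (1 - c cos(2 arctan t))⁻¹ = 2/((1-c) + (1+c)t²)`
(with `cos (2 arctan t) = (1 - t²)/(1 + t²)`, cf. `Literature.NumberTheory.LFunctions.cos_two_mul_arctan`).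
[folklore] -/
theorem weierstrass_integrand (c t : ℝ) (hc : |c| < 1) :
    2 / (1 + t ^ 2) * (1 - c * Real.cos (2 * Real.arctan t))⁻¹ = 2 / ((1 - c) + (1 + c) * t ^ 2) := by
  have h1 : 0 < 1 + t ^ 2 := by positivity
  have hc1 : 0 < 1 - c := by linarith [(abs_lt.1 hc).2]
  have hc2 : 0 < 1 + c := by linarith [(abs_lt.1 hc).1]
  have h2 : 0 < (1 - c) + (1 + c) * t ^ 2 := by positivity
  have hcos : Real.cos (2 * Real.arctan t) = (1 - t ^ 2) / (1 + t ^ 2) := by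
    rw [Real.cos_two_mul, Real.cos_arctan, div_pow, one_pow, Real.sq_sqrt h1.le]
    field_simp
    ring
  rw [hcos]
  have h3 : 1 - c * ((1 - t ^ 2) / (1 + t ^ 2)) = ((1 - c) + (1 + c) * t ^ 2) / (1 + t ^ 2) := by
    field_simp
    ring
  rw [h3, inv_div]
  field_simp

/-- `∫_ℝ dt/(a + b t²) = π/√(ab)` for `a, b > 0`. [folklore] -/
theorem integral_inv_add_mul_sq {a b : ℝ} (ha : 0 < a) (hb : 0 < b) :
    ∫ t : ℝ, (a + b * t ^ 2)⁻¹ = π / Real.sqrt (a * b) := by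
  set k : ℝ := Real.sqrt (b / a) with hk
  have hk0 : 0 < k := Real.sqrt_pos.2 (div_pos hb ha)
  have hk2 : k ^ 2 = b / a := Real.sq_sqrt (div_pos hb ha).le
  -- `(a + b t²)⁻¹ = a⁻¹ (1 + (k t)²)⁻¹`
  have hpt : ∀ t : ℝ, (a + b * t ^ 2)⁻¹ = a⁻¹ * (1 + (k * t) ^ 2)⁻¹ := by
    intro t
    rw [mul_pow, hk2, ← mul_inv]
    congr 1
    field_simp
  simp_rw [hpt]
  rw [MeasureTheory.integral_const_mul, Measure.integral_comp_mul_left (fun u : ℝ => (1 + u ^ 2)⁻¹) k,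
    integral_univ_inv_one_add_sq, abs_of_pos (inv_pos.2 hk0), smul_eq_mul]
  -- `a⁻¹ k⁻¹ π = π/√(ab)`
  have hsq : Real.sqrt (a * b) = a * k := by
    have h1 : a * k = Real.sqrt ((a * k) ^ 2) := (Real.sqrt_sq (by positivity)).symm
    rw [h1]
    congr 1
    rw [mul_pow, hk2]
    field_simp
  rw [hsq]
  field_simp

/-- **`∫_{-π}^{π} dp/(1 - c cos p) = 2π/√(1 - c²)`** for `|c| < 1` (Weierstrass substitution
`p = 2 arctan t`, under which `dp = 2 dt/(1+t²)` and `cos p = (1-t²)/(1+t²)`). [folklore] -/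
theorem integral_inv_one_sub_mul_cos {c : ℝ} (hc : |c| < 1) :
    ∫ p in (-π)..π, (1 - c * Real.cos p)⁻¹ = 2 * π / Real.sqrt (1 - c ^ 2) := by
  have hc1 : 0 < 1 - c := by linarith [(abs_lt.1 hc).2]
  have hc2 : 0 < 1 + c := by linarith [(abs_lt.1 hc).1]
  -- the substitution map `φ(t) = 2 arctan t` on `ℝ`, with image `(-π, π)`
  set φ : ℝ → ℝ := fun t => 2 * Real.arctan t with hφ
  have hφ' : ∀ t ∈ (univ : Set ℝ), HasDerivWithinAt φ (2 / (1 + t ^ 2)) univ t := by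
    intro t _
    have h := (Real.hasDerivAt_arctan t).const_mul 2
    have heq : 2 * (1 / (1 + t ^ 2)) = 2 / (1 + t ^ 2) := by ring
    rw [heq] at h
    exact h.hasDerivWithinAt
  have hmono : MonotoneOn φ univ := fun s _ t _ hst =>
    mul_le_mul_of_nonneg_left (Real.arctan_strictMono.monotone hst) (by norm_num)
  have himage : φ '' univ = Ioo (-π) π := by
    rw [image_univ]
    have : range φ = (fun y => 2 * y) '' range Real.arctan := by
      rw [← image_univ, ← image_univ, image_image]
    rw [this, Real.range_arctan, image_mul_left_Ioo (by norm_num : (0 : ℝ) < 2)]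
    congr 1 <;> ring
  -- change of variables
  have hcv := integral_image_eq_integral_deriv_smul_of_monotoneOn MeasurableSet.univ hφ' hmono
    (fun p => (1 - c * Real.cos p)⁻¹)
  rw [himage, Measure.restrict_univ] at hcv
  simp only [smul_eq_mul] at hcv
  rw [intervalIntegral.integral_of_le (by linarith [Real.pi_pos]), integral_Ioc_eq_integral_Ioo, hcv]
  simp_rw [hφ, weierstrass_integrand c _ hc]
  have h2 : ∀ t : ℝ, 2 / ((1 - c) + (1 + c) * t ^ 2) = 2 * ((1 - c) + (1 + c) * t ^ 2)⁻¹ :=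
    fun t => div_eq_mul_inv _ _
  simp_rw [h2]
  rw [MeasureTheory.integral_const_mul, integral_inv_add_mul_sq hc1 hc2]
  have h3 : (1 - c) * (1 + c) = 1 - c ^ 2 := by ring
  rw [h3]
  ring

/-! ### `∫_{-π}^{π} dp / (2 - cos p - cos (s - p)) = π / |sin (s/2)|` -/

/-- `2 - cos p - cos(s - p) = 2 (1 - cos(s/2) cos(p - s/2))` (sum-to-product). [folklore] -/
theorem two_sub_cos_sub_cos (s p : ℝ) :
    2 - Real.cos p - Real.cos (s - p) = 2 * (1 - Real.cos (s / 2) * Real.cos (p - s / 2)) := by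
  have h := Real.cos_add_cos p (s - p)
  have h1 : (p + (s - p)) / 2 = s / 2 := by ring
  have h2 : (p - (s - p)) / 2 = p - s / 2 := by ring
  rw [h1, h2] at h
  linarith

/-- For `s ∈ [-π, π] ∖ {0}`, `|cos (s/2)| < 1`. [folklore] -/
theorem abs_cos_half_lt_one {s : ℝ} (hs1 : -π ≤ s) (hs2 : s ≤ π) (hs0 : s ≠ 0) :
    |Real.cos (s / 2)| < 1 := by
  have hsin : Real.sin (s / 2) ≠ 0 := by
    intro h
    have h' := (Real.sin_eq_zero_iff_of_lt_of_lt (by linarith [Real.pi_pos]) (by linarith [Real.pi_pos])).1 h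
    exact hs0 (by linarith)
  have hle : |Real.cos (s / 2)| ≤ 1 := Real.abs_cos_le_one _
  refine lt_of_le_of_ne hle fun h => hsin ?_
  have h2 : Real.sin (s / 2) ^ 2 = 0 := by
    have := Real.sin_sq_add_cos_sq (s / 2)
    rw [← sq_abs (Real.cos _), h] at this
    linarith
  exact pow_eq_zero_iff (n := 2) (by norm_num) |>.1 h2

/-- **`∫_{-π}^{π} dp/(2 - cos p - cos(s - p)) = π/|sin(s/2)|`** for `s ∈ [-π, π] ∖ {0}`
(shift `p ↦ p + s/2` by periodicity, then `integral_inv_one_sub_mul_cos` with `c = cos(s/2)`,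
`√(1 - cos²(s/2)) = |sin(s/2)|`). [folklore] -/
theorem integral_inv_two_sub_cos_sub_cos {s : ℝ} (hs1 : -π ≤ s) (hs2 : s ≤ π) (hs0 : s ≠ 0) :
    ∫ p in (-π)..π, (2 - Real.cos p - Real.cos (s - p))⁻¹ = π / |Real.sin (s / 2)| := by
  set c := Real.cos (s / 2) with hc
  have hcabs : |c| < 1 := abs_cos_half_lt_one hs1 hs2 hs0
  -- the shifted integrand `h(q) = (2(1 - c cos q))⁻¹` is `2π`-periodic
  set h : ℝ → ℝ := fun q => (2 * (1 - c * Real.cos q))⁻¹ with hh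
  have hper : Function.Periodic h (2 * π) := fun q => by
    simp only [hh, Real.cos_add_two_pi]
  have heq : ∀ p, (2 - Real.cos p - Real.cos (s - p))⁻¹ = h (p - s / 2) := fun p => by
    simp only [hh, two_sub_cos_sub_cos s p, hc]
  simp_rw [heq]
  rw [intervalIntegral.integral_comp_sub_right h (s / 2)]
  -- move the window back to `[-π, π]` by periodicity
  have hwin : ∫ q in (-π - s / 2)..(π - s / 2), h q = ∫ q in (-π)..π, h q := by
    have h1 := hper.intervalIntegral_add_eq (-π - s / 2) (-π)
    have e1 : -π - s / 2 + 2 * π = π - s / 2 := by ring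
    have e2 : -π + 2 * π = π := by ring
    rw [e1, e2] at h1
    exact h1
  rw [hwin]
  have hsplit : ∀ q, h q = 2⁻¹ * (1 - c * Real.cos q)⁻¹ := fun q => by
    simp only [hh, mul_inv]
  simp_rw [hsplit]
  rw [intervalIntegral.integral_const_mul, integral_inv_one_sub_mul_cos hcabs]
  have hsq : Real.sqrt (1 - c ^ 2) = |Real.sin (s / 2)| := by
    rw [← Real.sqrt_sq_eq_abs]
    congr 1
    have := Real.sin_sq_add_cos_sq (s / 2)
    rw [hc]; linarith
  rw [hsq]
  ring

/-! ### The Dirichlet-type identity `(1 - cos 2nu)/sin u = 2 Σ_{k<n} sin((2k+1)u)` -/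

/-- `sin u · Σ_{k<n} sin((2k+1)u) = sin²(nu)` (telescoping `2 sin u sin((2k+1)u) =
cos(2ku) - cos((2k+2)u)`). [folklore] -/
theorem sin_mul_sum_sin_odd (u : ℝ) (n : ℕ) :
    Real.sin u * ∑ k ∈ Finset.range n, Real.sin ((2 * k + 1) * u) = Real.sin (n * u) ^ 2 := by
  induction n with
  | zero => simp
  | succ n ih =>
    rw [Finset.sum_range_succ, mul_add, ih]
    have h1 : Real.sin u * Real.sin ((2 * n + 1) * u) =
        (Real.cos (2 * n * u) - Real.cos ((2 * n + 2) * u)) / 2 := by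
      have e1 : 2 * (n : ℝ) * u = (2 * n + 1) * u - u := by ring
      have e2 : (2 * (n : ℝ) + 2) * u = (2 * n + 1) * u + u := by ring
      rw [e1, e2, Real.cos_sub, Real.cos_add]
      ring
    have h2 : Real.sin ((n : ℝ) * u) ^ 2 = (1 - Real.cos (2 * n * u)) / 2 := by
      rw [Real.sin_sq, Real.cos_sq]
      ring_nf
    have h3 : Real.sin (((n + 1 : ℕ) : ℝ) * u) ^ 2 = (1 - Real.cos ((2 * n + 2) * u)) / 2 := by
      rw [Real.sin_sq, Real.cos_sq]
      push_cast
      ring_nf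
    rw [h1, h2, h3]
    ring

/-- For `u` with `sin u ≠ 0` or `u = 0`: `(1 - cos(2nu)) · π / |sin u| = 2π |Σ_{k<n} sin((2k+1)u)|`;
we use it on `[0, π/2]`, where `sin u ≥ 0` and the sum is `≥ 0`, in the form
`(1 - cos(2nu)) π / sin u = 2π Σ_{k<n} sin((2k+1)u)` (both sides vanish at `u = 0`). [folklore] -/
theorem one_sub_cos_mul_div_sin (n : ℕ) {u : ℝ} (hu0 : 0 ≤ u) (hu1 : u ≤ π / 2) :
    (1 - Real.cos (2 * n * u)) * π / Real.sin u = 2 * π * ∑ k ∈ Finset.range n, Real.sin ((2 * k + 1) * u) := by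
  by_cases hu : u = 0
  · subst hu; simp
  have hsin : Real.sin u ≠ 0 := by
    have hpos : 0 < Real.sin u := Real.sin_pos_of_pos_of_lt_pi (lt_of_le_of_ne hu0 (Ne.symm hu))
      (by linarith [Real.pi_pos])
    exact hpos.ne'
  have h := sin_mul_sum_sin_odd u n
  have h2 : 1 - Real.cos (2 * n * u) = 2 * Real.sin (n * u) ^ 2 := by
    rw [Real.sin_sq, Real.cos_sq]
    ring_nf
  rw [h2, ← h, div_eq_iff hsin]
  ring

/-- `∫_0^{π/2} sin((2k+1)u) du = 1/(2k+1)`. [folklore] -/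
theorem integral_sin_odd_mul (k : ℕ) :
    ∫ u in (0 : ℝ)..(π / 2), Real.sin ((2 * k + 1) * u) = 1 / (2 * k + 1) := by
  have hk : (2 * (k : ℝ) + 1) ≠ 0 := by positivity
  rw [intervalIntegral.integral_comp_mul_left (fun x => Real.sin x) hk, integral_sin, mul_zero,
    Real.cos_zero, smul_eq_mul]
  have hcos : Real.cos ((2 * k + 1) * (π / 2)) = 0 := by
    rw [Real.cos_eq_zero_iff]
    exact ⟨k, by push_cast; ring⟩
  rw [hcos]
  ring

/-- The odd-frequency sine sum `S(s) = Σ_{k<n} sin((2k+1)s/2)` is odd. [folklore] -/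
theorem sum_sin_odd_neg (n : ℕ) (s : ℝ) :
    ∑ k ∈ Finset.range n, Real.sin ((2 * k + 1) * (-s / 2)) =
      -∑ k ∈ Finset.range n, Real.sin ((2 * k + 1) * (s / 2)) := by
  rw [← Finset.sum_neg_distrib]
  refine Finset.sum_congr rfl fun k _ => ?_
  rw [← Real.sin_neg]
  congr 1; ring

/-- On `[0, π]`: `(1 - cos ns) π/|sin(s/2)| = 2π Σ_{k<n} sin((2k+1)s/2)` and the sum is `≥ 0`.
[folklore] -/
theorem eq_sum_of_mem_Icc (n : ℕ) {s : ℝ} (hs : s ∈ Set.Icc (0 : ℝ) π) :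
    (1 - Real.cos (n * s)) * π / |Real.sin (s / 2)| =
        2 * π * ∑ k ∈ Finset.range n, Real.sin ((2 * k + 1) * (s / 2)) ∧
      0 ≤ ∑ k ∈ Finset.range n, Real.sin ((2 * k + 1) * (s / 2)) := by
  have hu0 : 0 ≤ s / 2 := by linarith [hs.1]
  have hu1 : s / 2 ≤ π / 2 := by linarith [hs.2]
  have hsin : 0 ≤ Real.sin (s / 2) :=
    Real.sin_nonneg_of_nonneg_of_le_pi hu0 (by linarith [hs.2, Real.pi_pos])
  have h := one_sub_cos_mul_div_sin n hu0 hu1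
  have e1 : 2 * (n : ℝ) * (s / 2) = n * s := by ring
  rw [e1] at h
  refine ⟨by rw [abs_of_nonneg hsin]; exact h, ?_⟩
  -- nonnegativity: `2π Σ = (1 - cos ns) π / sin(s/2) ≥ 0`
  have hnum : 0 ≤ (1 - Real.cos (n * s)) * π / Real.sin (s / 2) :=
    div_nonneg (mul_nonneg (sub_nonneg.2 (Real.cos_le_one _)) Real.pi_pos.le) hsin
  rw [h] at hnum
  have h2π : (0 : ℝ) < 2 * π := by positivity
  exact (mul_nonneg_iff_of_pos_left h2π).1 hnum

/-- On `[-π, π]`: `(1 - cos ns) π/|sin(s/2)| = 2π |Σ_{k<n} sin((2k+1)s/2)|`. [folklore] -/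
theorem eq_abs_sum_of_mem_Icc (n : ℕ) {s : ℝ} (hs : s ∈ Set.Icc (-π) π) :
    (1 - Real.cos (n * s)) * π / |Real.sin (s / 2)| =
      2 * π * |∑ k ∈ Finset.range n, Real.sin ((2 * k + 1) * (s / 2))| := by
  rcases le_total 0 s with h0 | h0
  · obtain ⟨h1, h2⟩ := eq_sum_of_mem_Icc n ⟨h0, hs.2⟩
    rw [h1, abs_of_nonneg h2]
  · -- use evenness of the left side and oddness of the sum
    obtain ⟨h1, h2⟩ := eq_sum_of_mem_Icc n (s := -s) ⟨by linarith, by linarith [hs.1]⟩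
    have hev : (1 - Real.cos (n * s)) * π / |Real.sin (s / 2)| =
        (1 - Real.cos (n * -s)) * π / |Real.sin (-s / 2)| := by
      rw [mul_neg, Real.cos_neg, neg_div, Real.sin_neg, abs_neg]
    rw [hev, h1, sum_sin_odd_neg] at *
    rw [abs_of_nonpos (by linarith)]

/-- **`∫_{-π}^{π} (1 - cos ns) π/|sin(s/2)| ds = 8π Σ_{k<n} 1/(2k+1)`** (the integrand equals the
continuous `2π|Σ_{k<n} sin((2k+1)s/2)|`; evenness, and `∫_0^{π} sin((2k+1)s/2) ds = 2/(2k+1)`).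
[folklore] -/
theorem integral_one_sub_cos_mul_div_abs_sin (n : ℕ) :
    ∫ s in (-π)..π, (1 - Real.cos (n * s)) * π / |Real.sin (s / 2)| =
      8 * π * ∑ k ∈ Finset.range n, (1 : ℝ) / (2 * k + 1) := by
  set S : ℝ → ℝ := fun s => ∑ k ∈ Finset.range n, Real.sin ((2 * k + 1) * (s / 2)) with hS
  have hScont : Continuous S := by
    refine continuous_finsetSum _ fun k _ => ?_
    exact Real.continuous_sin.comp (continuous_const.mul (continuous_id.div_const _))
  have habsint : ∀ a b : ℝ, IntervalIntegrable (fun s => 2 * π * |S s|) volume a b := fun a b =>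
    (continuous_const.mul hScont.abs).intervalIntegrable a b
  have hπ : 0 ≤ π := Real.pi_pos.le
  -- replace the integrand by `2π|S|` on `[-π, π]`
  have h1 : ∫ s in (-π)..π, (1 - Real.cos (n * s)) * π / |Real.sin (s / 2)| =
      ∫ s in (-π)..π, 2 * π * |S s| := by
    refine intervalIntegral.integral_congr fun s hs => ?_
    rw [uIcc_of_le (by linarith)] at hs
    exact eq_abs_sum_of_mem_Icc n hs
  rw [h1, ← intervalIntegral.integral_add_adjacent_intervals (habsint (-π) 0) (habsint 0 π)]
  -- the two halves agree
  have hodd : ∀ s, S (-s) = -S s := fun s => by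
    simp only [hS]
    have := sum_sin_odd_neg n s
    rwa [neg_div] at this ⊢
  have h2 : ∫ s in (-π)..(0 : ℝ), 2 * π * |S s| = ∫ s in (0 : ℝ)..π, 2 * π * |S s| := by
    have h := intervalIntegral.integral_comp_neg (fun s => 2 * π * |S s|) (a := (0 : ℝ)) (b := π)
    simp only [neg_zero, hodd, abs_neg] at h
    exact h.symm
  -- the integral over `[0, π]`
  have h3 : ∫ s in (0 : ℝ)..π, 2 * π * |S s| = 4 * π * ∑ k ∈ Finset.range n, (1 : ℝ) / (2 * k + 1) := by
    have h31 : ∫ s in (0 : ℝ)..π, 2 * π * |S s| = ∫ s in (0 : ℝ)..π, 2 * π * S s := by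
      refine intervalIntegral.integral_congr fun s hs => ?_
      rw [uIcc_of_le hπ] at hs
      rw [abs_of_nonneg (eq_sum_of_mem_Icc n hs).2]
    rw [h31, intervalIntegral.integral_const_mul]
    simp only [hS]
    rw [intervalIntegral.integral_finsetSum]
    · rw [Finset.mul_sum, Finset.mul_sum]
      refine Finset.sum_congr rfl fun k _ => ?_
      have hk : ∫ s in (0 : ℝ)..π, Real.sin ((2 * k + 1) * (s / 2)) = 2 / (2 * k + 1) := by
        have e : (fun s : ℝ => Real.sin ((2 * k + 1) * (s / 2))) = fun s => Real.sin ((2 * k + 1) * (2⁻¹ * s)) := by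
          funext s; ring_nf
        rw [e, intervalIntegral.integral_comp_mul_left (fun u => Real.sin ((2 * k + 1) * u))
          (by norm_num : (2 : ℝ)⁻¹ ≠ 0), inv_inv, mul_zero, smul_eq_mul]
        have e2 : (2 : ℝ)⁻¹ * π = π / 2 := by ring
        rw [e2, integral_sin_odd_mul]
        ring
      rw [hk]
      ring
    · intro k _
      exact (Real.continuous_sin.comp (continuous_const.mul (continuous_id.div_const _))).intervalIntegrable _ _
  rw [h2, h3]
  ring

/-! ### The diagonal integrand on `ℝ²`, its periodicity and boundedness -/

-- No definitions are introduced: the site `(n, n)` is written `fun _ : Fin 2 => (n : ℤ)`, and the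
-- potential-kernel integrand of `(n, n)` in two real coordinates is written out,
-- `F(a, b) = (1 - cos(n(a + b)))/(2 - cos a - cos b)`.

/-- The integrand of `a(n,n)` is `F` read on `ℝ²`. [folklore] -/
theorem potentialIntegrand_diag (n : ℕ) (p : Fin 2 → ℝ) :
    potentialIntegrand (fun _ : Fin 2 => ((n : ℕ) : ℤ)) p = ((1 : ℝ) - Real.cos ((n : ℝ) * ((p 0) + (p 1)))) / (2 - Real.cos (p 0) - Real.cos (p 1)) := by
  simp only [potentialIntegrand, dispersion, Fin.sum_univ_two, Int.cast_natCast]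
  congr 1
  · congr 1; congr 1; ring
  · ring

/-- Reduction of an angle to `(-π, π]`. [folklore] -/
theorem cos_toIocMod (b : ℝ) : Real.cos (toIocMod Real.two_pi_pos (-π) b) = Real.cos b := by
  rw [← self_sub_toIocDiv_zsmul, zsmul_eq_mul, Real.cos_sub_int_mul_two_pi]

/-- The reduced angle lies in `[-π, π]`. [folklore] -/
theorem toIocMod_mem_Icc (b : ℝ) : toIocMod Real.two_pi_pos (-π) b ∈ Set.Icc (-π) π := by
  have h := toIocMod_mem_Ioc Real.two_pi_pos (-π) b
  have e : -π + 2 * π = π := by ring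
  rw [e] at h
  exact Ioc_subset_Icc_self h

/-- `F` is doubly `2π`-periodic: it only sees the reduced angles. [folklore] -/
theorem F_toIocMod (n : ℕ) (a b : ℝ) :
    ((1 : ℝ) - Real.cos ((n : ℝ) * ((toIocMod Real.two_pi_pos (-π) a) + (toIocMod Real.two_pi_pos (-π) b)))) / (2 - Real.cos (toIocMod Real.two_pi_pos (-π) a) - Real.cos (toIocMod Real.two_pi_pos (-π) b)) = ((1 : ℝ) - Real.cos ((n : ℝ) * (a + b))) / (2 - Real.cos a - Real.cos b) := by
  simp only [cos_toIocMod]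
  congr 2
  rw [← self_sub_toIocDiv_zsmul Real.two_pi_pos (-π) a, ← self_sub_toIocDiv_zsmul Real.two_pi_pos (-π) b,
    zsmul_eq_mul, zsmul_eq_mul]
  set k := toIocDiv Real.two_pi_pos (-π) a
  set l := toIocDiv Real.two_pi_pos (-π) b
  have e : (n : ℝ) * (a - k * (2 * π) + (b - l * (2 * π))) = n * (a + b) - ((n * (k + l) : ℤ) : ℝ) * (2 * π) := by
    push_cast; ring
  rw [e, Real.cos_sub_int_mul_two_pi]

/-- `0 ≤ F ≤ π² n²` everywhere (the bound of `potentialIntegrand_le` on the Brillouin zone,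
transported by periodicity). [folklore] -/
theorem F_nonneg_and_le (n : ℕ) (a b : ℝ) : 0 ≤ ((1 : ℝ) - Real.cos ((n : ℝ) * (a + b))) / (2 - Real.cos a - Real.cos b) ∧ ((1 : ℝ) - Real.cos ((n : ℝ) * (a + b))) / (2 - Real.cos a - Real.cos b) ≤ π ^ 2 * n ^ 2 := by
  set a' := toIocMod Real.two_pi_pos (-π) a
  set b' := toIocMod Real.two_pi_pos (-π) b
  have hmem : (![a', b'] : Fin 2 → ℝ) ∈ brillouin 2 := by
    intro i _
    fin_cases i
    · exact toIocMod_mem_Icc a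
    · exact toIocMod_mem_Icc b
  have h1 := potentialIntegrand_nonneg (fun _ : Fin 2 => ((n : ℕ) : ℤ)) ![a', b']
  have h2 := potentialIntegrand_le hmem (fun _ : Fin 2 => ((n : ℕ) : ℤ))
  rw [potentialIntegrand_diag] at h1 h2
  have e : ((1 : ℝ) - Real.cos ((n : ℝ) * (((![a', b'] : Fin 2 → ℝ) 0) + ((![a', b'] : Fin 2 → ℝ) 1)))) / (2 - Real.cos ((![a', b'] : Fin 2 → ℝ) 0) - Real.cos ((![a', b'] : Fin 2 → ℝ) 1)) = ((1 : ℝ) - Real.cos ((n : ℝ) * (a + b))) / (2 - Real.cos a - Real.cos b) := by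
    show ((1 : ℝ) - Real.cos ((n : ℝ) * (a' + b'))) / (2 - Real.cos a' - Real.cos b') = ((1 : ℝ) - Real.cos ((n : ℝ) * (a + b))) / (2 - Real.cos a - Real.cos b)
    exact F_toIocMod n a b
  rw [e] at h1 h2
  refine ⟨h1, h2.trans (le_of_eq ?_)⟩
  simp only [Fin.sum_univ_two, Int.cast_natCast, Nat.abs_cast]
  ring

/-- `F(a, ·)` is `2π`-periodic. [folklore] -/
theorem F_periodic_right (n : ℕ) (a : ℝ) : Function.Periodic (fun b => ((1 : ℝ) - Real.cos ((n : ℝ) * (a + b))) / (2 - Real.cos a - Real.cos b)) (2 * π) := fun b => by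
  simp only [Real.cos_add_two_pi]
  congr 2
  have e : (n : ℝ) * (a + (b + 2 * π)) = n * (a + b) + n * (2 * π) := by ring
  rw [e, Real.cos_add_nat_mul_two_pi]

/-- `F` is jointly measurable. [folklore] -/
theorem measurable_F (n : ℕ) : Measurable fun q : ℝ × ℝ => ((1 : ℝ) - Real.cos ((n : ℝ) * (q.1 + q.2))) / (2 - Real.cos q.1 - Real.cos q.2) := by
  fun_prop

/-- The sheared integrand `G(p, s) = F(p, s - p) = (1 - cos ns)/(2 - cos p - cos(s - p))` is
jointly measurable. [folklore] -/
theorem measurable_F_shear (n : ℕ) : Measurable fun q : ℝ × ℝ => ((1 : ℝ) - Real.cos ((n : ℝ) * (q.1 + (q.2 - q.1)))) / (2 - Real.cos q.1 - Real.cos (q.2 - q.1)) := by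
  fun_prop

/-! ### Fubini on the square and the shear `p₂ = s - p₁` -/

/-- The Brillouin zone of `ℤ²` is the preimage of the square under `p ↦ (p 0, p 1)`. [folklore] -/
theorem brillouin_two_eq_preimage :
    brillouin 2 = (MeasurableEquiv.finTwoArrow : (Fin 2 → ℝ) ≃ᵐ ℝ × ℝ) ⁻¹' (Set.Icc (-π) π ×ˢ Set.Icc (-π) π) := by
  ext p
  simp only [brillouin, Set.mem_pi, Set.mem_univ, true_implies, Set.mem_preimage, Set.mem_prod]
  exact ⟨fun h => ⟨h 0, h 1⟩, fun h i => by fin_cases i <;> [exact h.1; exact h.2]⟩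

/-- **Step 1** — the Fourier integral of `a(n,n)` as an integral over the square in `ℝ²`.
[folklore] -/
theorem integral_brillouin_eq_integral_square (n : ℕ) :
    ∫ p in brillouin 2, potentialIntegrand (fun _ : Fin 2 => ((n : ℕ) : ℤ)) p =
      ∫ q in Set.Icc (-π) π ×ˢ Set.Icc (-π) π, ((1 : ℝ) - Real.cos ((n : ℝ) * (q.1 + q.2))) / (2 - Real.cos q.1 - Real.cos q.2) := by
  have h := (volume_preserving_finTwoArrow ℝ).setIntegral_preimage_emb
    (MeasurableEquiv.finTwoArrow : (Fin 2 → ℝ) ≃ᵐ ℝ × ℝ).measurableEmbedding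
    (fun q : ℝ × ℝ => ((1 : ℝ) - Real.cos ((n : ℝ) * (q.1 + q.2))) / (2 - Real.cos q.1 - Real.cos q.2)) (Set.Icc (-π) π ×ˢ Set.Icc (-π) π)
  rw [← brillouin_two_eq_preimage] at h
  rw [← h]
  refine setIntegral_congr_fun (measurableSet_brillouin 2) fun p _ => ?_
  exact potentialIntegrand_diag n p

/-- `F` is integrable on the square. [folklore] -/
theorem integrableOn_F_square (n : ℕ) :
    IntegrableOn (fun q : ℝ × ℝ => ((1 : ℝ) - Real.cos ((n : ℝ) * (q.1 + q.2))) / (2 - Real.cos q.1 - Real.cos q.2)) (Set.Icc (-π) π ×ˢ Set.Icc (-π) π) := by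
  refine Measure.integrableOn_of_bounded (M := π ^ 2 * n ^ 2) ?_ (measurable_F n).aestronglyMeasurable ?_
  · exact ((isCompact_Icc.prod isCompact_Icc).measure_lt_top).ne
  · refine ae_of_all _ fun q => ?_
    rw [Real.norm_eq_abs, abs_of_nonneg (F_nonneg_and_le n q.1 q.2).1]
    exact (F_nonneg_and_le n q.1 q.2).2

/-- The sheared integrand is integrable on the square. [folklore] -/
theorem integrableOn_F_shear_square (n : ℕ) :
    IntegrableOn (fun q : ℝ × ℝ => ((1 : ℝ) - Real.cos ((n : ℝ) * (q.1 + (q.2 - q.1)))) / (2 - Real.cos q.1 - Real.cos (q.2 - q.1))) (Set.Icc (-π) π ×ˢ Set.Icc (-π) π) := by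
  refine Measure.integrableOn_of_bounded (M := π ^ 2 * n ^ 2) ?_ (measurable_F_shear n).aestronglyMeasurable ?_
  · exact ((isCompact_Icc.prod isCompact_Icc).measure_lt_top).ne
  · refine ae_of_all _ fun q => ?_
    rw [Real.norm_eq_abs, abs_of_nonneg (F_nonneg_and_le n q.1 _).1]
    exact (F_nonneg_and_le n q.1 _).2

/-- **Step 2** — the shear in the inner integral: `∫_{-π}^{π} F(p, p₂) dp₂ = ∫_{-π}^{π} F(p, s - p) ds`
(periodicity of `F(p, ·)`). [folklore] -/
theorem setIntegral_F_right_eq_shear (n : ℕ) (a : ℝ) :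
    ∫ b in Set.Icc (-π) π, ((1 : ℝ) - Real.cos ((n : ℝ) * (a + b))) / (2 - Real.cos a - Real.cos b) = ∫ s in Set.Icc (-π) π, ((1 : ℝ) - Real.cos ((n : ℝ) * (a + (s - a)))) / (2 - Real.cos a - Real.cos (s - a)) := by
  have hπ : -π ≤ π := by linarith [Real.pi_pos]
  rw [integral_Icc_eq_integral_Ioc, integral_Icc_eq_integral_Ioc, ← intervalIntegral.integral_of_le hπ,
    ← intervalIntegral.integral_of_le hπ, intervalIntegral.integral_comp_sub_right (fun b => ((1 : ℝ) - Real.cos ((n : ℝ) * (a + b))) / (2 - Real.cos a - Real.cos b)) a]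
  have h1 := (F_periodic_right n a).intervalIntegral_add_eq (-π - a) (-π)
  have e1 : -π - a + 2 * π = π - a := by ring
  have e2 : -π + 2 * π = π := by ring
  rw [e1, e2] at h1
  exact h1.symm

/-- **Step 3** — the inner integral after the shear, for `s ≠ 0`:
`∫_{-π}^{π} F(p, s - p) dp = (1 - cos ns) π/|sin(s/2)|`. [folklore] -/
theorem setIntegral_F_shear_left (n : ℕ) {s : ℝ} (hs : s ∈ Set.Icc (-π) π) (hs0 : s ≠ 0) :
    ∫ a in Set.Icc (-π) π, ((1 : ℝ) - Real.cos ((n : ℝ) * (a + (s - a)))) / (2 - Real.cos a - Real.cos (s - a)) = (1 - Real.cos (n * s)) * π / |Real.sin (s / 2)| := by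
  have hπ : -π ≤ π := by linarith [Real.pi_pos]
  rw [integral_Icc_eq_integral_Ioc, ← intervalIntegral.integral_of_le hπ]
  have e : ∀ a, ((1 : ℝ) - Real.cos ((n : ℝ) * (a + (s - a)))) / (2 - Real.cos a - Real.cos (s - a)) = (1 - Real.cos (n * s)) * (2 - Real.cos a - Real.cos (s - a))⁻¹ := fun a => by
    simp only [add_sub_cancel, div_eq_mul_inv]
  simp_rw [e]
  rw [intervalIntegral.integral_const_mul, integral_inv_two_sub_cos_sub_cos hs.1 hs.2 hs0]
  ring

/-- **The potential kernel of `ℤ²` on the diagonal** (McCrea–Whipple 1940; Spitzer 1976 §15 P3;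
Lawler–Limic 2010, proof of Thm. 4.4.4): in the normalisation `Δ a = 2δ₀` of
`LatticePotentialKernel.lean`,
`a(n, n) = (2/π) Σ_{k<n} 1/(2k+1)` (`= ½ · (4/π)(1 + 1/3 + ⋯ + 1/(2n-1))`).
[cite: LawlerLimic2010, Thm. 4.4.4 (proof)] -/
theorem latticePotentialKernel_diagonal (n : ℕ) :
    latticePotentialKernel 2 (fun _ : Fin 2 => ((n : ℕ) : ℤ)) = 2 / π * ∑ k ∈ Finset.range n, (1 : ℝ) / (2 * k + 1) := by
  rw [latticePotentialKernel_eq, integral_brillouin_eq_integral_square]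
  -- Fubini on the square
  have hvol : (volume : Measure (ℝ × ℝ)) = (volume : Measure ℝ).prod (volume : Measure ℝ) := rfl
  have h1 : ∫ q in Set.Icc (-π) π ×ˢ Set.Icc (-π) π, ((1 : ℝ) - Real.cos ((n : ℝ) * (q.1 + q.2))) / (2 - Real.cos q.1 - Real.cos q.2) =
      ∫ a in Set.Icc (-π) π, ∫ b in Set.Icc (-π) π, ((1 : ℝ) - Real.cos ((n : ℝ) * (a + b))) / (2 - Real.cos a - Real.cos b) := by
    rw [hvol, setIntegral_prod (fun q : ℝ × ℝ => ((1 : ℝ) - Real.cos ((n : ℝ) * (q.1 + q.2))) / (2 - Real.cos q.1 - Real.cos q.2)) (integrableOn_F_square n)]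
  -- the shear in the inner integral
  have h2 : ∫ a in Set.Icc (-π) π, ∫ b in Set.Icc (-π) π, ((1 : ℝ) - Real.cos ((n : ℝ) * (a + b))) / (2 - Real.cos a - Real.cos b) =
      ∫ a in Set.Icc (-π) π, ∫ s in Set.Icc (-π) π, ((1 : ℝ) - Real.cos ((n : ℝ) * (a + (s - a)))) / (2 - Real.cos a - Real.cos (s - a)) :=
    integral_congr_ae (ae_of_all _ fun a => setIntegral_F_right_eq_shear n a)
  -- swap the order of integration
  have h3 : ∫ a in Set.Icc (-π) π, ∫ s in Set.Icc (-π) π, ((1 : ℝ) - Real.cos ((n : ℝ) * (a + (s - a)))) / (2 - Real.cos a - Real.cos (s - a)) =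
      ∫ s in Set.Icc (-π) π, ∫ a in Set.Icc (-π) π, ((1 : ℝ) - Real.cos ((n : ℝ) * (a + (s - a)))) / (2 - Real.cos a - Real.cos (s - a)) := by
    refine integral_integral_swap (f := fun a s => ((1 : ℝ) - Real.cos ((n : ℝ) * (a + (s - a)))) / (2 - Real.cos a - Real.cos (s - a))) ?_
    rw [Measure.prod_restrict, ← hvol]
    exact integrableOn_F_shear_square n
  -- evaluate the inner integral off `s = 0`
  have h4 : ∫ s in Set.Icc (-π) π, ∫ a in Set.Icc (-π) π, ((1 : ℝ) - Real.cos ((n : ℝ) * (a + (s - a)))) / (2 - Real.cos a - Real.cos (s - a)) =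
      ∫ s in Set.Icc (-π) π, (1 - Real.cos (n * s)) * π / |Real.sin (s / 2)| := by
    refine setIntegral_congr_ae (g := fun s => (1 - Real.cos (n * s)) * π / |Real.sin (s / 2)|)
      measurableSet_Icc ?_
    have hae : ∀ᵐ s : ℝ ∂volume, s ≠ 0 := by
      rw [ae_iff]
      simp
    filter_upwards [hae] with s hs0 hs
    exact setIntegral_F_shear_left n hs hs0
  have hπ : -π ≤ π := by linarith [Real.pi_pos]
  rw [h1, h2, h3, h4, integral_Icc_eq_integral_Ioc, ← intervalIntegral.integral_of_le hπ,
    integral_one_sub_cos_mul_div_abs_sin]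
  have hπ0 : π ≠ 0 := Real.pi_pos.ne'
  field_simp
  ring

/-! ### The odd harmonic sum and Euler's constant -/

/-- `Σ_{k<n} 1/(2k+1) = H_{2n} - H_n/2`. [folklore] -/
theorem sum_inv_odd_eq_harmonic (n : ℕ) :
    ∑ k ∈ Finset.range n, (1 : ℝ) / (2 * k + 1) = (harmonic (2 * n) : ℝ) - (harmonic n : ℝ) / 2 := by
  induction n with
  | zero => simp
  | succ n ih =>
    rw [Finset.sum_range_succ, ih]
    have e : 2 * (n + 1) = 2 * n + 1 + 1 := by ring
    rw [e, harmonic_succ, harmonic_succ, harmonic_succ]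
    push_cast
    have h1 : (2 * (n : ℝ) + 1) ≠ 0 := by positivity
    have h2 : ((n : ℝ) + 1) ≠ 0 := by positivity
    have h3 : (2 * (n : ℝ) + 1 + 1) ≠ 0 := by positivity
    field_simp
    ring

/-- **`0 < H_m - log m - γ ≤ 1/m`** for `m ≥ 1` (Mathlib's monotone sequences
`H_m - log(m+1) ↑ γ`, `H_m - log m ↓ γ`, and `log(1 + 1/m) ≤ 1/m`). [folklore] -/
theorem harmonic_sub_log_sub_eulerMascheroni {m : ℕ} (hm : 1 ≤ m) :
    0 < (harmonic m : ℝ) - Real.log m - Real.eulerMascheroniConstant ∧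
      (harmonic m : ℝ) - Real.log m - Real.eulerMascheroniConstant ≤ 1 / m := by
  have hm0 : (0 : ℝ) < m := by exact_mod_cast hm
  have h1 := Real.eulerMascheroniConstant_lt_eulerMascheroniSeq' m
  have h2 := Real.eulerMascheroniSeq_lt_eulerMascheroniConstant m
  rw [Real.eulerMascheroniSeq', if_neg (by omega)] at h1
  rw [Real.eulerMascheroniSeq] at h2
  refine ⟨by linarith, ?_⟩
  have hlog : Real.log ((m : ℝ) + 1) - Real.log m ≤ 1 / m := by
    rw [← Real.log_div (by positivity) hm0.ne']
    have e : ((m : ℝ) + 1) / m = 1 + 1 / m := by field_simp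
    rw [e]
    have := Real.log_le_sub_one_of_pos (by positivity : (0 : ℝ) < 1 + 1 / m)
    linarith
  linarith

/-- `|(n, n)| = n√2` for the planar embedding `Site.toComplex`. [folklore] -/
theorem norm_toComplex_diag (n : ℕ) : ‖Site.toComplex (fun _ : Fin 2 => ((n : ℕ) : ℤ))‖ = n * Real.sqrt 2 := by
  have h : Site.toComplex (fun _ : Fin 2 => ((n : ℕ) : ℤ)) = (n : ℂ) * (1 + Complex.I) := by
    apply Complex.ext <;> simp [Site.toComplex]
  rw [h, norm_mul, Complex.norm_natCast]
  congr 1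
  rw [Complex.norm_eq_sqrt_sq_add_sq]
  norm_num

/-- **The constant of the planar potential kernel, read off on the diagonal**: for `n ≥ 1`,
`|a(n,n) - (1/π) log |(n,n)| - k₀/2| ≤ 2/(π n)` with `k₀ = (2γ + 3 log 2)/π`
(`KozdronLawler.greenConst`; the tree's `a` is half of Kozdron–Lawler's, whence `k₀/2` and
`(1/π) log` in place of `k₀` and `(2/π) log` in "`a(x) = (2/π) log |x| + k₀ + o(1)`", eq. (16)).
[cite: KozdronLawler2005, §2.3 eq. (16)] -/
theorem abs_latticePotentialKernel_diagonal_sub_log_sub_le {n : ℕ} (hn : 1 ≤ n) :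
    |latticePotentialKernel 2 (fun _ : Fin 2 => ((n : ℕ) : ℤ)) - 1 / π * Real.log ‖Site.toComplex (fun _ : Fin 2 => ((n : ℕ) : ℤ))‖ -
        KozdronLawler.greenConst / 2| ≤ 2 / (π * n) := by
  have hn0 : (0 : ℝ) < n := by exact_mod_cast hn
  have hπ := Real.pi_pos
  rw [latticePotentialKernel_diagonal, sum_inv_odd_eq_harmonic, norm_toComplex_diag,
    Real.log_mul hn0.ne' (by positivity), Real.log_sqrt (by norm_num : (0 : ℝ) ≤ 2),
    KozdronLawler.greenConst]
  obtain ⟨h1, h2⟩ := harmonic_sub_log_sub_eulerMascheroni hn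
  obtain ⟨h3, h4⟩ := harmonic_sub_log_sub_eulerMascheroni (m := 2 * n) (by omega)
  set ε₁ := (harmonic n : ℝ) - Real.log n - Real.eulerMascheroniConstant with hε₁
  set ε₂ := (harmonic (2 * n) : ℝ) - Real.log ((2 * n : ℕ) : ℝ) - Real.eulerMascheroniConstant with hε₂
  have hlog2n : Real.log ((2 * n : ℕ) : ℝ) = Real.log 2 + Real.log n := by
    push_cast
    exact Real.log_mul (by norm_num) hn0.ne'
  -- the quantity inside the absolute value is `(2/π)(ε₂ - ε₁/2)`
  have hkey : 2 / π * ((harmonic (2 * n) : ℝ) - (harmonic n : ℝ) / 2) -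
      1 / π * (Real.log n + Real.log 2 / 2) -
      (2 * Real.eulerMascheroniConstant + 3 * Real.log 2) / π / 2 = 2 / π * (ε₂ - ε₁ / 2) := by
    simp only [hε₁, hε₂, hlog2n]
    field_simp
    ring
  rw [hkey, abs_mul, abs_of_pos (by positivity : (0 : ℝ) < 2 / π)]
  have e : (1 : ℝ) / ((2 * n : ℕ) : ℝ) = 1 / (2 * n) := by push_cast; ring
  rw [e] at h4
  have hb : |ε₂ - ε₁ / 2| ≤ 1 / n := by
    have h2' : ε₁ / 2 ≤ 1 / (2 * n) := by
      rw [show (1 : ℝ) / (2 * n) = (1 / n) / 2 by field_simp]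
      linarith
    have hsum : 1 / (2 * (n : ℝ)) + 1 / (2 * n) = 1 / n := by field_simp; ring
    rw [abs_le]
    constructor
    · nlinarith
    · nlinarith
  calc 2 / π * |ε₂ - ε₁ / 2| ≤ 2 / π * (1 / n) := by gcongr
    _ = 2 / (π * n) := by field_simp

end PotentialKernelDiagonal

end Literature.Probability.LatticeModels

end
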